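import Summits.AtomisticToContinuum.Crystallization.Theorems.ThreeConeCertificateExactCertificateSlacknessEnergy

/-!
# `ExactCertificate` (stmt-AtomisticToContinuum-11959), line `closure-makes-nogap-exact`:
# the registered stubs `stub_noGap` and `stub_periodicMinimum` are NECESSARY

Support file for the crux `ThreeConeCertificate.ExactCertificate` (line lead).  The line's
skeleton proves `stub_noGap ∧ stub_closure ∧ stub_periodicMinimum → ExactCertificate`; here we
prove the two converses

* `noGap_of_exactCertificate` : `ExactCertificate →` (the registered signature of `stub_noGap`),
  with `ρ₀ := ρ`, `Q := P` and the witness's own `f` at every `ε` — by complementary slackness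
  (`…SlacknessBlocks`, `…SlacknessEnergy`): the tail clause is
  `f 0 + 2e_P(f·1_{<ρ}) + 2e_P(V_LJ·1_{≥ρ}) = f 0 + 2e_P(f) = 0` (`f = V_LJ` on `D_P ∩ [ρ,∞)`),
  and the core clause holds with constant `e_P((V_LJ − f)·1_{<ρ}) = e_P(g) = −c` because
  `(V_LJ − f)·1_{(0,ρ)} = g + U·1_{(0,ρ)} ≥ g` is `c`-stable;
* `periodicMinimum_of_exactCertificate` : `ExactCertificate →` (the registered signature of
  `stub_periodicMinimum`): the witness configuration attains `e* = ⨅_Q e(Q)`.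

So, given the (provable, analytic) closure stub, the line is TIGHT:
`ExactCertificate ↔ stub_noGap ∧ stub_periodicMinimum`.  All `[folklore]`.
-/

noncomputable section

namespace Summit.AtomisticToContinuum.Crystallization.Theorems.ThreeConeCertificateExactCertificate.Slackness

open Literature.MathematicalPhysics.StatisticalMechanics
open Summit.AtomisticToContinuum.Crystallization.Theses.ThreeConeCertificate
open Summit.AtomisticToContinuum.Crystallization.Theorems.ChargedEnergyGapNegative
  (E3 eStar eStar_le)
open Summit.AtomisticToContinuum.Crystallization.Theorems.ChargedEnergyGapNegative.Blocks
  (BIdx blockConfig blockConfig_injective card_BIdx exists_block_energy_le siteSum depth)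
open Summit.AtomisticToContinuum.Crystallization.Theorems.ExactCertificateNegative
  (IsSplit exactCertificate_iff sum_sum_eq interactionEnergy_add interactionEnergy_congr_pos)
open scoped BigOperators

/-! ## Two elementary tools -/

/-- Energies are monotone in the potential on injective configurations. [folklore] -/
theorem interactionEnergy_mono_pos {V W : ℝ → ℝ} (h : ∀ r, 0 < r → V r ≤ W r) {N : ℕ}
    {x : Fin N → E3} (hx : Function.Injective x) :
    interactionEnergy V x ≤ interactionEnergy W x := by
  unfold interactionEnergy
  refine Finset.sum_le_sum fun i _ => Finset.sum_le_sum fun j hj => h _ ?_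
  exact dist_pos.2 fun heq => (Finset.mem_Ioi.1 hj).ne' (hx heq.symm)

/-- Two potentials that agree on the distance set `D_P ∖ {0}` of a periodic configuration have the
same energy per particle on it (termwise equality of the site sums; no summability needed).
[folklore] -/
theorem energyPerParticle_congr_points (P : PeriodicConfiguration 3) {V W : ℝ → ℝ}
    (h : ∀ p ∈ P.points, ∀ q ∈ P.points, p ≠ q → V (dist p q) = W (dist p q)) :
    P.energyPerParticle V = P.energyPerParticle W := by
  unfold PeriodicConfiguration.energyPerParticle
  congr 1
  refine Finset.sum_congr rfl fun x hx => tsum_congr fun q => ?_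
  exact h x (P.mem_points_of_mem_motif hx) q.1 q.2.1 (fun heq => q.2.2 heq.symm)

/-! ## Lattice-sum accounting for truncated potentials -/

/-- Additivity of the energy per particle for summable site families. [folklore] -/
theorem energyPerParticle_add (Q : PeriodicConfiguration 3) {W₁ W₂ : ℝ → ℝ}
    (h₁ : ∀ x ∈ Q.motif, Summable fun q : {y : E3 // y ∈ Q.points ∧ y ≠ x} => W₁ (dist x q.1))
    (h₂ : ∀ x ∈ Q.motif, Summable fun q : {y : E3 // y ∈ Q.points ∧ y ≠ x} => W₂ (dist x q.1)) :
    Q.energyPerParticle (fun r => W₁ r + W₂ r) = Q.energyPerParticle W₁ + Q.energyPerParticle W₂ := by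
  unfold PeriodicConfiguration.energyPerParticle
  rw [← mul_add, ← Finset.sum_add_distrib]
  congr 1
  exact Finset.sum_congr rfl fun x hx => (h₁ x hx).tsum_add (h₂ x hx)

/-- A core truncation `W·1_{(−∞,ρ)}` vanishes on `[ρ,∞)`. [folklore] -/
theorem core_eq_zero (ρ : ℝ) (W : ℝ → ℝ) :
    ∀ r, ρ ≤ r → (fun r => if r < ρ then W r else 0) r = 0 := fun r hr => by
  show (if r < ρ then W r else 0) = 0
  rw [if_neg (not_lt.2 hr)]

/-- Core truncations have summable (indeed finite) site families. [folklore] -/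
theorem summable_core (Q : PeriodicConfiguration 3) (ρ : ℝ) (W : ℝ → ℝ) (p : E3) :
    Summable fun q : {q : E3 // q ∈ Q.points ∧ q ≠ p} => (if dist p q.1 < ρ then W (dist p q.1) else 0) :=
  summable_of_finRange Q (W := fun r => if r < ρ then W r else 0) (core_eq_zero ρ W) p

/-- `e_Q(V_LJ) = e_Q(V_LJ·1_{(0,ρ)}) + e_Q(V_LJ·1_{[ρ,∞)})`. [folklore] -/
theorem energyPerParticle_split_range (Q : PeriodicConfiguration 3) (ρ : ℝ) :
    Q.energyPerParticle lennardJones =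
      Q.energyPerParticle (fun r => if r < ρ then lennardJones r else 0) +
        Q.energyPerParticle (fun r => if r < ρ then 0 else lennardJones r) := by
  have h₁ : ∀ x ∈ Q.motif, Summable fun q : {y : E3 // y ∈ Q.points ∧ y ≠ x} =>
      (if dist x q.1 < ρ then lennardJones (dist x q.1) else 0) := fun x _ =>
    summable_core Q ρ lennardJones x
  have h₂ : ∀ x ∈ Q.motif, Summable fun q : {y : E3 // y ∈ Q.points ∧ y ≠ x} =>
      (if dist x q.1 < ρ then 0 else lennardJones (dist x q.1)) := fun x hx => by
    refine ((Q.summable_lennardJones_dist_three x).sub (h₁ x hx)).congr fun q => ?_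
    show lennardJones (dist x q.1) - (if dist x q.1 < ρ then lennardJones (dist x q.1) else 0) =
      (if dist x q.1 < ρ then 0 else lennardJones (dist x q.1))
    split_ifs <;> simp
  have hadd := energyPerParticle_add Q (W₁ := fun r => if r < ρ then lennardJones r else 0)
    (W₂ := fun r => if r < ρ then 0 else lennardJones r) h₁ h₂
  rw [← hadd]
  exact energyPerParticle_congr_points Q fun p _ q _ _ => by
    show lennardJones (dist p q) = (if dist p q < ρ then lennardJones (dist p q) else 0) +
      (if dist p q < ρ then 0 else lennardJones (dist p q))
    split_ifs <;> simp

/-! ## Weak duality for the tail functional -/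

/-- **The tail functional is non-negative** for EVERY periodic `Q` and every radial positive-type `f`
lying below `V_LJ` beyond `ρ`: `0 ≤ f 0 + 2e_Q(f·1_{<ρ}) + 2e_Q(V_LJ·1_{≥ρ})`.  (Bochner with unit
weights on the `K`-blocks of `Q`, `f ≤ V_LJ` on the tail pairs, the finite-range block identity for the
two core truncations and `E_LJ(block) ≤ N(e(Q) + ε)`.)  So the tail clause of `stub_noGap` is an
`inf = 0` statement. [folklore] -/
theorem tailSlack_nonneg (Q : PeriodicConfiguration 3) {ρ : ℝ} {f : ℝ → ℝ}
    (hpd : ∀ (n : ℕ) (y : Fin n → E3) (w : Fin n → ℝ), 0 ≤ ∑ i, ∑ j, w i * w j * f (dist (y i) (y j)))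
    (htail : ∀ r : ℝ, ρ ≤ r → 0 < r → f r ≤ lennardJones r) :
    0 ≤ f 0 + 2 * Q.energyPerParticle (fun r => if r < ρ then f r else 0) +
      2 * Q.energyPerParticle (fun r => if r < ρ then 0 else lennardJones r) := by
  set ecF : ℝ := Q.energyPerParticle (fun r => if r < ρ then f r else 0) with hecF
  set etV : ℝ := Q.energyPerParticle (fun r => if r < ρ then 0 else lennardJones r) with hetV
  set ecV : ℝ := Q.energyPerParticle (fun r => if r < ρ then lennardJones r else 0) with hecV
  set F : ℝ := (Q.motif.card : ℝ) with hFdef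
  have hF : 0 < F := by rw [hFdef]; exact_mod_cast Q.motif_nonempty.card_pos
  set Cf : ℝ := 6 * depth Q ρ * ∑ x ∈ Q.motif, siteSum Q (fun r => |(if r < ρ then f r else 0)|) x
    with hCf
  set CV : ℝ := 6 * depth Q ρ * ∑ x ∈ Q.motif, siteSum Q (fun r => |(if r < ρ then lennardJones r else 0)|) x
    with hCV
  have hbf : ∀ K : ℕ, |2 * interactionEnergy (fun r => if r < ρ then f r else 0) (blockConfig Q K) -
      (K : ℝ) ^ 3 * (2 * F * ecF)| ≤ Cf * (K : ℝ) ^ 2 := by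
    intro K
    have := abs_two_mul_energy_block_sub_le Q (W := fun r => if r < ρ then f r else 0)
      (core_eq_zero ρ f) K
    rw [hCf, hecF, hFdef]
    calc _ ≤ _ := this
      _ = _ := by ring
  have hbV : ∀ K : ℕ, |2 * interactionEnergy (fun r => if r < ρ then lennardJones r else 0)
      (blockConfig Q K) - (K : ℝ) ^ 3 * (2 * F * ecV)| ≤ CV * (K : ℝ) ^ 2 := by
    intro K
    have := abs_two_mul_energy_block_sub_le Q (W := fun r => if r < ρ then lennardJones r else 0)
      (core_eq_zero ρ lennardJones) K
    rw [hCV, hecV, hFdef]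
    calc _ ≤ _ := this
      _ = _ := by ring
  have hcard : ∀ K : ℕ, ((Fintype.card (BIdx Q K) : ℕ) : ℝ) = F * (K : ℝ) ^ 3 := fun K => by
    rw [card_BIdx]; push_cast; rw [hFdef]
  have hsplitV := energyPerParticle_split_range Q ρ
  -- `S ≥ −2ε` for every `ε > 0`
  have key : ∀ ε : ℝ, 0 < ε → 0 ≤ f 0 + 2 * ecF + 2 * etV + 2 * ε := by
    intro ε hε
    obtain ⟨K₀, -, hK⟩ := exists_block_energy_le Q hε
    have hle : -(F * (f 0 + 2 * ecF + 2 * etV + 2 * ε)) ≤ 0 := by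
      refine nonpos_of_cubic_le_sq (b := Cf + CV) ⟨K₀, fun K hKK => ?_⟩
      have hx := blockConfig_injective Q K
      -- (1) Bochner with unit weights on the block
      have h0 := hpd _ (blockConfig Q K) (fun _ => 1)
      simp only [one_mul] at h0
      rw [sum_sum_eq] at h0
      -- (2) core/tail decomposition of `E_f` and `E_V` on the block
      have h2 : interactionEnergy f (blockConfig Q K) =
          interactionEnergy (fun r => if r < ρ then f r else 0) (blockConfig Q K) +
            interactionEnergy (fun r => if r < ρ then 0 else f r) (blockConfig Q K) := by
        rw [← interactionEnergy_add]
        exact interactionEnergy_congr_pos (fun r _ => by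
          show f r = (if r < ρ then f r else 0) + (if r < ρ then 0 else f r)
          split_ifs <;> simp) hx
      have h4 : interactionEnergy lennardJones (blockConfig Q K) =
          interactionEnergy (fun r => if r < ρ then lennardJones r else 0) (blockConfig Q K) +
            interactionEnergy (fun r => if r < ρ then 0 else lennardJones r) (blockConfig Q K) := by
        rw [← interactionEnergy_add]
        exact interactionEnergy_congr_pos (fun r _ => by
          show lennardJones r = (if r < ρ then lennardJones r else 0) + (if r < ρ then 0 else lennardJones r)
          split_ifs <;> simp) hx
      -- (3) `f ≤ V_LJ` on the tail pairs
      have h3 : interactionEnergy (fun r => if r < ρ then 0 else f r) (blockConfig Q K) ≤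
          interactionEnergy (fun r => if r < ρ then 0 else lennardJones r) (blockConfig Q K) := by
        refine interactionEnergy_mono_pos (fun r hr => ?_) hx
        show (if r < ρ then 0 else f r) ≤ (if r < ρ then 0 else lennardJones r)
        split_ifs with hlt
        · exact le_rfl
        · exact htail r (not_lt.1 hlt) hr
      -- (5) blocks are trial states
      have h5 := hK K hKK
      rw [hcard] at h0 h5
      have h6a := (abs_le.1 (hbf K)).2
      have h6b := (abs_le.1 (hbV K)).1
      rw [hsplitV] at h5
      nlinarith [h0, h2, h3, h4, h5, h6a, h6b]
    nlinarith
  refine le_of_forall_pos_le_add fun ε hε => ?_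
  have := key (ε / 2) (by positivity)
  linarith

/-! ## The witness's own split has no gap at its own range -/

section Witness

variable {P : PeriodicConfiguration 3} {ρ c : ℝ} {g U f : ℝ → ℝ}

/-- **The core constant of the normal form is `−c`**: for a witness,
`e_P((V_LJ − f)·1_{<ρ}) = e_P(g) = −c` (on the distances of `P` below `ρ` one has
`V_LJ − f = g + U = g` since `U = 0` on `D_P`; above `ρ` both sides vanish). [folklore] -/
theorem energyPerParticle_core_eq (h : IsSplit ρ c g U f)
    (hv : c + f 0 / 2 ≤ -(P.energyPerParticle lennardJones)) :
    P.energyPerParticle (fun r => if r < ρ then lennardJones r - f r else 0) = -c := by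
  rw [← energyPerParticle_g_eq h hv]
  refine energyPerParticle_congr_points P fun p hp q hq hpq => ?_
  have hd : 0 < dist p q := dist_pos.2 hpq
  show (if dist p q < ρ then lennardJones (dist p q) - f (dist p q) else 0) = g (dist p q)
  split_ifs with hlt
  · have h1 := h.split _ hd
    have h2 := U_eq_zero_of_mem_points h hv hp hq hpq
    linarith
  · exact (h.g_zero _ (not_lt.1 hlt)).symm

/-- **The core part `(V_LJ − f)·1_{<ρ}` dominates `g` on `(0,∞)`**, hence is `c`-stable. [folklore] -/
theorem stable_core (h : IsSplit ρ c g U f) {N : ℕ} {x : Fin N → E3} (hx : Function.Injective x) :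
    -(c * (N : ℝ)) ≤ interactionEnergy (fun r => if r < ρ then lennardJones r - f r else 0) x := by
  refine (h.stable N x hx).trans (interactionEnergy_mono_pos (fun r hr => ?_) hx)
  show g r ≤ (if r < ρ then lennardJones r - f r else 0)
  split_ifs with hlt
  · have h1 := h.split r hr
    have h2 := h.U_nonneg r hr
    linarith
  · exact (h.g_zero r (not_lt.1 hlt)).le

/-- **The tail functional of a witness vanishes**:
`f 0 + 2e_P(f·1_{<ρ}) + 2e_P(V_LJ·1_{≥ρ}) = 0` — it equals `f 0 + 2e_P(f)` because `f = V_LJ` on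
`D_P ∩ [ρ,∞)`, and that vanishes by complementary slackness for the Bochner cone. [folklore] -/
theorem tail_functional_eq_zero (h : IsSplit ρ c g U f)
    (hv : c + f 0 / 2 ≤ -(P.energyPerParticle lennardJones)) :
    f 0 + 2 * P.energyPerParticle (fun r => if r < ρ then f r else 0) +
      2 * P.energyPerParticle (fun r => if r < ρ then 0 else lennardJones r) = 0 := by
  have hcore0 : ∀ r, ρ ≤ r → (fun r => if r < ρ then f r else 0) r = 0 := fun r hr => by
    show (if r < ρ then f r else 0) = 0
    rw [if_neg (not_lt.2 hr)]
  -- `e_P(f) = e_P(core) + e_P(tail V)`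
  have hsplit : P.energyPerParticle f = P.energyPerParticle (fun r => if r < ρ then f r else 0) +
      P.energyPerParticle (fun r => if r < ρ then 0 else lennardJones r) := by
    have hpt : ∀ p ∈ P.points, ∀ q ∈ P.points, p ≠ q → f (dist p q) =
        (if dist p q < ρ then f (dist p q) else 0) +
          (if dist p q < ρ then 0 else lennardJones (dist p q)) := by
      intro p hp q hq hpq
      split_ifs with hlt
      · ring
      · rw [zero_add]
        exact f_eq_lennardJones_of_mem_points h hv hp hq hpq (not_lt.1 hlt)
    rw [energyPerParticle_congr_points P (W := fun r => (if r < ρ then f r else 0) +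
      (if r < ρ then 0 else lennardJones r)) hpt]
    unfold PeriodicConfiguration.energyPerParticle
    rw [← mul_add, ← Finset.sum_add_distrib]
    congr 1
    refine Finset.sum_congr rfl fun x hx => ?_
    have hxP := P.mem_points_of_mem_motif hx
    have hc : Summable fun q : {q : E3 // q ∈ P.points ∧ q ≠ x} =>
        (if dist x q.1 < ρ then f (dist x q.1) else 0) :=
      summable_of_finRange P (W := fun r => if r < ρ then f r else 0) hcore0 x
    have ht : Summable fun q : {q : E3 // q ∈ P.points ∧ q ≠ x} =>
        (if dist x q.1 < ρ then 0 else lennardJones (dist x q.1)) := by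
      refine ((summable_f_site h hv hxP).sub hc).congr fun q => ?_
      have := hpt x hxP q.1 q.2.1 (fun heq => q.2.2 heq.symm)
      show f (dist x q.1) - (if dist x q.1 < ρ then f (dist x q.1) else 0) = _
      linarith
    exact hc.tsum_add ht
  have h0 := f_zero_add_two_mul_energyPerParticle_f h hv
  rw [hsplit] at h0
  linarith

/-- **NO GAP AT THE WITNESS'S OWN RANGE** (the registered signature of `stub_noGap` after `∃ ρ₀`,
realised by `ρ₀ := ρ`, `Q := P` and the witness's `f` for every `ε > 0`). [folklore] -/
theorem noGap_of_witness (h : IsSplit ρ c g U f)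
    (hv : c + f 0 / 2 ≤ -(P.energyPerParticle lennardJones)) :
    ∀ ε : ℝ, 0 < ε → ∃ (Q : PeriodicConfiguration 3) (f : ℝ → ℝ),
      (∀ (n : ℕ) (y : Fin n → EuclideanSpace ℝ (Fin 3)) (w : Fin n → ℝ),
        0 ≤ ∑ i, ∑ j, w i * w j * f (dist (y i) (y j))) ∧
      (∀ r : ℝ, ρ ≤ r → 0 < r → f r ≤ lennardJones r) ∧
      f 0 + 2 * Q.energyPerParticle (fun r => if r < ρ then f r else 0) +
          2 * Q.energyPerParticle (fun r => if r < ρ then 0 else lennardJones r) ≤ ε ∧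
      (∀ (N : ℕ) (x : Fin N → EuclideanSpace ℝ (Fin 3)), Function.Injective x →
        (N : ℝ) * (Q.energyPerParticle (fun r => if r < ρ then lennardJones r - f r else 0) - ε) ≤
          interactionEnergy (fun r => if r < ρ then lennardJones r - f r else 0) x) := by
  intro ε hε
  refine ⟨P, f, h.posType, fun r hρ hr => h.f_le_tail hρ hr, ?_, fun N x hx => ?_⟩
  · rw [tail_functional_eq_zero h hv]
    exact hε.le
  · rw [energyPerParticle_core_eq h hv]
    have h1 := stable_core h hx
    have hN : (0 : ℝ) ≤ N := Nat.cast_nonneg N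
    nlinarith

/-- **A witness configuration is a periodic minimiser** (the registered signature of
`stub_periodicMinimum`, realised by the witness's `P`). [folklore] -/
theorem periodicMinimum_of_witness (h : IsSplit ρ c g U f)
    (hv : c + f 0 / 2 ≤ -(P.energyPerParticle lennardJones)) (Q : PeriodicConfiguration 3) :
    P.energyPerParticle lennardJones ≤ Q.energyPerParticle lennardJones := by
  rw [(witness_eq h hv).1]
  exact eStar_le Q

end Witness

/-! ## Necessity of the registered stubs -/

/-- **`ExactCertificate → stub_noGap`** (registered signature of the line
`closure-makes-nogap-exact`, verbatim): the crux implies the no-gap statement, with `ρ₀` the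
witness's range. [folklore] -/
theorem noGap_of_exactCertificate (hE : ExactCertificate) :
    ∃ ρ₀ : ℝ, ∀ ε : ℝ, 0 < ε → ∃ (Q : PeriodicConfiguration 3) (f : ℝ → ℝ),
      (∀ (n : ℕ) (y : Fin n → EuclideanSpace ℝ (Fin 3)) (w : Fin n → ℝ),
        0 ≤ ∑ i, ∑ j, w i * w j * f (dist (y i) (y j))) ∧
      (∀ r : ℝ, ρ₀ ≤ r → 0 < r → f r ≤ lennardJones r) ∧
      f 0 + 2 * Q.energyPerParticle (fun r => if r < ρ₀ then f r else 0) +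
          2 * Q.energyPerParticle (fun r => if r < ρ₀ then 0 else lennardJones r) ≤ ε ∧
      (∀ (N : ℕ) (x : Fin N → EuclideanSpace ℝ (Fin 3)), Function.Injective x →
        (N : ℝ) * (Q.energyPerParticle (fun r => if r < ρ₀ then lennardJones r - f r else 0) - ε) ≤
          interactionEnergy (fun r => if r < ρ₀ then lennardJones r - f r else 0) x) := by
  obtain ⟨P, ρ, c, g, U, f, hs, hv⟩ := exactCertificate_iff.1 hE
  exact ⟨ρ, noGap_of_witness hs hv.le⟩

/-- **`ExactCertificate → stub_periodicMinimum`** (registered signature, verbatim): the crux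
implies that the periodic infimum of the Lennard-Jones energy per particle is attained. [folklore] -/
theorem periodicMinimum_of_exactCertificate (hE : ExactCertificate) :
    ∃ P : PeriodicConfiguration 3, ∀ Q : PeriodicConfiguration 3,
      P.energyPerParticle lennardJones ≤ Q.energyPerParticle lennardJones := by
  obtain ⟨P, ρ, c, g, U, f, hs, hv⟩ := exactCertificate_iff.1 hE
  exact ⟨P, periodicMinimum_of_witness hs hv.le⟩

/-- **Registered stub `stub_necessity` of the line `closure-makes-nogap-exact`** (signature
verbatim): the crux implies both open stubs `stub_noGap` and `stub_periodicMinimum`. [folklore] -/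
theorem stub_necessity : ExactCertificate →
    (∃ ρ₀ : ℝ, ∀ ε : ℝ, 0 < ε → ∃ (Q : PeriodicConfiguration 3) (f : ℝ → ℝ),
      (∀ (n : ℕ) (y : Fin n → EuclideanSpace ℝ (Fin 3)) (w : Fin n → ℝ),
        0 ≤ ∑ i, ∑ j, w i * w j * f (dist (y i) (y j))) ∧
      (∀ r : ℝ, ρ₀ ≤ r → 0 < r → f r ≤ lennardJones r) ∧
      f 0 + 2 * Q.energyPerParticle (fun r => if r < ρ₀ then f r else 0) +
          2 * Q.energyPerParticle (fun r => if r < ρ₀ then 0 else lennardJones r) ≤ ε ∧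
      (∀ (N : ℕ) (x : Fin N → EuclideanSpace ℝ (Fin 3)), Function.Injective x →
        (N : ℝ) * (Q.energyPerParticle (fun r => if r < ρ₀ then lennardJones r - f r else 0) - ε) ≤
          interactionEnergy (fun r => if r < ρ₀ then lennardJones r - f r else 0) x)) ∧
    (∃ P : PeriodicConfiguration 3, ∀ Q : PeriodicConfiguration 3,
      P.energyPerParticle lennardJones ≤ Q.energyPerParticle lennardJones) :=
  fun hE => ⟨noGap_of_exactCertificate hE, periodicMinimum_of_exactCertificate hE⟩

end Summit.AtomisticToContinuum.Crystallization.Theorems.ThreeConeCertificateExactCertificate.Slackness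

end
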